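import Mathlib
import Summits.Ventures.PercRepro2.HCov
import Summits.Ventures.PercRepro2.RECMReduction
import Summits.Ventures.PercRepro2.A3Reduction
import Summits.Ventures.PercRepro2.CutVertexPaths
import Summits.Ventures.PercRepro2.IsolatedMark
import Summits.Ventures.PercRepro2.GcSkelRules
import Summits.Ventures.PercRepro2.GcSkelReduction
import Summits.Ventures.PercRepro2.GcSkelReductionI
import Summits.Ventures.PercRepro2.GcSkelCutShape
import Summits.Ventures.PercRepro2.GcSkelCutShapeSplits

/-!
# The one open shape: every cut vertex of the residual is an `a₃`-pendant (blind cell PercRepro2,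
typer-1 g53)

The case analysis on the positions of the five marks at a cut vertex of a `WRed.WReducedI`
instance with a non-loop edge on each side (the closers are `GcSkelCutShape.lean` and
`GcSkelCutShapeSplits.lean`): each mark is
on the left, at the cut vertex, or on the right; two marks at the cut vertex contradict their
distinctness; otherwise the placement is excluded by `prune` / `oneFar` (through
`noMarkBehindCut_of_wredI`) / `twoThree`, or it is the `a₃`-pendant shape.

* **`cutVertex_shape_of_wredI`**: every cut vertex of a `WReducedI` instance with a non-loop edge on
  each side is `A3PendantCut` in one of its two orientations;
* **`nonLoopDeg_a3_eq_one_of_shape`**, **`three_le_nonLoopDeg_v_of_shape`**: the shape is an `a₃`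
  leaf at an unmarked vertex of non-loop degree `≥ 3` — S3.10's (G1);
* **`no_cutVertex_of_wredI_of_a3_not_leaf`**: on the residual with `a₃` not a leaf, no cut vertex
  has a non-loop edge on each side — beyond (G1) the residual is two-connected on its edge-carrying
  part.
-/

namespace Summit.Ventures.PercRepro2

open CovForm RECM CutVertexM9

namespace WRed

section Cases

variable {V : Type*} {E : Type*} [Fintype E] [DecidableEq V]
variable {ends : E → Sym2 V} {side : E → Bool} {L : Set V} {v : V} {Rt : Set V} {o a₁ a₂ a₃ b : V}

/-- **`a₃` on the left**: the placements of `o, a₁, a₂, b`. -/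
lemma shape_cases_a3_left (h : WReducedI ends o a₁ a₂ a₃ b) (hcut : CutVertex ends side L v Rt)
    (hR : ∃ g, side g = false ∧ ¬ (ends g).IsDiag)
    (h12 : a₁ ≠ a₂) (ho1 : o ≠ a₁) (ho2 : o ≠ a₂) (hob : o ≠ b) (hb1 : b ≠ a₁) (hb2 : b ≠ a₂)
    (h3L : a₃ ∈ L) (h3Lv : a₃ ∈ L ∨ a₃ = v) :
    A3PendantCut ends side L v Rt o a₁ a₂ a₃ b ∨
      A3PendantCut ends (fun e => !side e) Rt v L o a₁ a₂ a₃ b := by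
  rcases pos_of_not_isolated hcut h.notIso_o with ⟨hoL, hoLv⟩ | ⟨hoV, hoLv, hoRv⟩ | ⟨hoR, hoRv⟩ <;>
  rcases pos_of_not_isolated hcut h.notIso_a1 with ⟨h1L, h1Lv⟩ | ⟨h1V, h1Lv, h1Rv⟩ | ⟨h1R, h1Rv⟩ <;>
  rcases pos_of_not_isolated hcut h.notIso_a2 with ⟨h2L, h2Lv⟩ | ⟨h2V, h2Lv, h2Rv⟩ | ⟨h2R, h2Rv⟩ <;>
  rcases pos_of_not_isolated hcut h.notIso_b with ⟨hbL, hbLv⟩ | ⟨hbV, hbLv, hbRv⟩ | ⟨hbR, hbRv⟩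
  all_goals first
    | exact absurd (‹o = v›.trans ‹a₁ = v›.symm) ho1
    | exact absurd (‹o = v›.trans ‹a₂ = v›.symm) ho2
    | exact absurd (‹o = v›.trans ‹b = v›.symm) hob
    | exact absurd (‹a₁ = v›.trans ‹a₂ = v›.symm) h12
    | exact absurd (‹b = v›.trans ‹a₁ = v›.symm) hb1
    | exact absurd (‹b = v›.trans ‹a₂ = v›.symm) hb2
    | exact Or.inl (shape_left h hcut h3L ‹_› ‹_› ‹_› ‹_›)
    | exact (prune_right h hcut ‹_› ‹_› ‹_› h3Lv ‹_› hR).elim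
    | exact (oneRight_o h hcut ‹_› ‹_› ‹_› h3Lv ‹_›).elim
    | exact (oneRight_a1 h hcut ‹_› ‹_› ‹_› h3Lv ‹_›).elim
    | exact (oneRight_a2 h hcut ‹_› ‹_› ‹_› h3Lv ‹_›).elim
    | exact (oneRight_b h hcut ‹_› ‹_› ‹_› ‹_› h3Lv).elim
    | exact (twoThree_2 h hcut ‹_› h3Lv ‹_› ‹_› ‹_›).elim
    | exact (twoThree_3 h hcut ‹_› h3Lv ‹_› ‹_› ‹_›).elim
    | exact (twoThree_8 h hcut ‹_› h3Lv ‹_› ‹_› ‹_›).elim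
    | exact (twoThree_9 h hcut h3Lv ‹_› ‹_› ‹_› ‹_›).elim
    | exact (twoThree_1' h hcut ‹_› ‹_› ‹_› h3Lv ‹_›).elim
    | exact (twoThree_4' h hcut ‹_› ‹_› ‹_› h3Lv ‹_›).elim
    | exact (twoThree_5' h hcut ‹_› ‹_› ‹_› h3Lv ‹_›).elim
    | exact (twoThree_6' h hcut ‹_› ‹_› ‹_› h3Lv ‹_›).elim
    | exact (twoThree_7' h hcut ‹_› ‹_› ‹_› h3Lv ‹_›).elim
    | exact (twoThree_10' h hcut ‹_› ‹_› ‹_› ‹_› h3Lv).elim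

/-- **`a₃` on the right**: the placements of `o, a₁, a₂, b`. -/
lemma shape_cases_a3_right (h : WReducedI ends o a₁ a₂ a₃ b) (hcut : CutVertex ends side L v Rt)
    (hL : ∃ g, side g = true ∧ ¬ (ends g).IsDiag)
    (h12 : a₁ ≠ a₂) (ho1 : o ≠ a₁) (ho2 : o ≠ a₂) (hob : o ≠ b) (hb1 : b ≠ a₁) (hb2 : b ≠ a₂)
    (h3R : a₃ ∈ Rt) (h3Rv : a₃ ∈ Rt ∨ a₃ = v) :
    A3PendantCut ends side L v Rt o a₁ a₂ a₃ b ∨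
      A3PendantCut ends (fun e => !side e) Rt v L o a₁ a₂ a₃ b := by
  rcases pos_of_not_isolated hcut h.notIso_o with ⟨hoL, hoLv⟩ | ⟨hoV, hoLv, hoRv⟩ | ⟨hoR, hoRv⟩ <;>
  rcases pos_of_not_isolated hcut h.notIso_a1 with ⟨h1L, h1Lv⟩ | ⟨h1V, h1Lv, h1Rv⟩ | ⟨h1R, h1Rv⟩ <;>
  rcases pos_of_not_isolated hcut h.notIso_a2 with ⟨h2L, h2Lv⟩ | ⟨h2V, h2Lv, h2Rv⟩ | ⟨h2R, h2Rv⟩ <;>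
  rcases pos_of_not_isolated hcut h.notIso_b with ⟨hbL, hbLv⟩ | ⟨hbV, hbLv, hbRv⟩ | ⟨hbR, hbRv⟩
  all_goals first
    | exact absurd (‹o = v›.trans ‹a₁ = v›.symm) ho1
    | exact absurd (‹o = v›.trans ‹a₂ = v›.symm) ho2
    | exact absurd (‹o = v›.trans ‹b = v›.symm) hob
    | exact absurd (‹a₁ = v›.trans ‹a₂ = v›.symm) h12
    | exact absurd (‹b = v›.trans ‹a₁ = v›.symm) hb1
    | exact absurd (‹b = v›.trans ‹a₂ = v›.symm) hb2
    | exact Or.inr (shape_right h hcut h3R ‹_› ‹_› ‹_› ‹_›)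
    | exact (prune_left h hcut ‹_› ‹_› ‹_› h3Rv ‹_› hL).elim
    | exact (oneLeft_o h hcut ‹_› ‹_› ‹_› h3Rv ‹_›).elim
    | exact (oneLeft_a1 h hcut ‹_› ‹_› ‹_› h3Rv ‹_›).elim
    | exact (oneLeft_a2 h hcut ‹_› ‹_› ‹_› h3Rv ‹_›).elim
    | exact (oneLeft_b h hcut ‹_› ‹_› ‹_› ‹_› h3Rv).elim
    | exact (twoThree_2' h hcut ‹_› h3Rv ‹_› ‹_› ‹_›).elim
    | exact (twoThree_3' h hcut ‹_› h3Rv ‹_› ‹_› ‹_›).elim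
    | exact (twoThree_8' h hcut ‹_› h3Rv ‹_› ‹_› ‹_›).elim
    | exact (twoThree_9' h hcut h3Rv ‹_› ‹_› ‹_› ‹_›).elim
    | exact (twoThree_1 h hcut ‹_› ‹_› ‹_› h3Rv ‹_›).elim
    | exact (twoThree_4 h hcut ‹_› ‹_› ‹_› h3Rv ‹_›).elim
    | exact (twoThree_5 h hcut ‹_› ‹_› ‹_› h3Rv ‹_›).elim
    | exact (twoThree_6 h hcut ‹_› ‹_› ‹_› h3Rv ‹_›).elim
    | exact (twoThree_7 h hcut ‹_› ‹_› ‹_› h3Rv ‹_›).elim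
    | exact (twoThree_10 h hcut ‹_› ‹_› ‹_› ‹_› h3Rv).elim

/-- **`a₃` at the cut vertex**: impossible. -/
lemma shape_cases_a3_at_v (h : WReducedI ends o a₁ a₂ a₃ b) (hcut : CutVertex ends side L v Rt)
    (hL : ∃ g, side g = true ∧ ¬ (ends g).IsDiag) (hR : ∃ g, side g = false ∧ ¬ (ends g).IsDiag)
    (h13 : a₁ ≠ a₃) (h23 : a₂ ≠ a₃) (ho3 : o ≠ a₃) (hb3 : b ≠ a₃)
    (h3V : a₃ = v) (h3Lv : a₃ ∈ L ∨ a₃ = v) (h3Rv : a₃ ∈ Rt ∨ a₃ = v) : False := by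
  rcases pos_of_not_isolated hcut h.notIso_o with ⟨hoL, hoLv⟩ | ⟨hoV, hoLv, hoRv⟩ | ⟨hoR, hoRv⟩ <;>
  rcases pos_of_not_isolated hcut h.notIso_a1 with ⟨h1L, h1Lv⟩ | ⟨h1V, h1Lv, h1Rv⟩ | ⟨h1R, h1Rv⟩ <;>
  rcases pos_of_not_isolated hcut h.notIso_a2 with ⟨h2L, h2Lv⟩ | ⟨h2V, h2Lv, h2Rv⟩ | ⟨h2R, h2Rv⟩ <;>
  rcases pos_of_not_isolated hcut h.notIso_b with ⟨hbL, hbLv⟩ | ⟨hbV, hbLv, hbRv⟩ | ⟨hbR, hbRv⟩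
  all_goals first
    | exact absurd (‹o = v›.trans h3V.symm) ho3
    | exact absurd (‹a₁ = v›.trans h3V.symm) h13
    | exact absurd (‹a₂ = v›.trans h3V.symm) h23
    | exact absurd (‹b = v›.trans h3V.symm) hb3
    | exact prune_left h hcut ‹_› ‹_› ‹_› h3Rv ‹_› hL
    | exact prune_right h hcut ‹_› ‹_› ‹_› h3Lv ‹_› hR
    | exact oneLeft_o h hcut ‹_› ‹_› ‹_› h3Rv ‹_›
    | exact oneLeft_a1 h hcut ‹_› ‹_› ‹_› h3Rv ‹_›
    | exact oneLeft_a2 h hcut ‹_› ‹_› ‹_› h3Rv ‹_›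
    | exact oneLeft_b h hcut ‹_› ‹_› ‹_› ‹_› h3Rv
    | exact oneRight_o h hcut ‹_› ‹_› ‹_› h3Lv ‹_›
    | exact oneRight_a1 h hcut ‹_› ‹_› ‹_› h3Lv ‹_›
    | exact oneRight_a2 h hcut ‹_› ‹_› ‹_› h3Lv ‹_›
    | exact oneRight_b h hcut ‹_› ‹_› ‹_› ‹_› h3Lv
    | exact twoThree_1 h hcut ‹_› ‹_› ‹_› h3Rv ‹_›
    | exact twoThree_4 h hcut ‹_› ‹_› ‹_› h3Rv ‹_›
    | exact twoThree_5 h hcut ‹_› ‹_› ‹_› h3Rv ‹_›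
    | exact twoThree_6 h hcut ‹_› ‹_› ‹_› h3Rv ‹_›
    | exact twoThree_7 h hcut ‹_› ‹_› ‹_› h3Rv ‹_›
    | exact twoThree_10 h hcut ‹_› ‹_› ‹_› ‹_› h3Rv

end Cases

section Main

variable {V : Type*} {E : Type*} [Fintype E] [DecidableEq V]
variable {ends : E → Sym2 V} {side : E → Bool} {L : Set V} {v : V} {Rt : Set V} {o a₁ a₂ a₃ b : V}

/-- **THE ONE OPEN SHAPE**: on the residual `WReducedI`, every cut vertex with a non-loop edge on
each side is the `a₃`-pendant shape `A3PendantCut`, in one of its two orientations. -/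
theorem cutVertex_shape_of_wredI (h : WReducedI ends o a₁ a₂ a₃ b)
    (hcut : CutVertex ends side L v Rt)
    (hL : ∃ g, side g = true ∧ ¬ (ends g).IsDiag) (hR : ∃ g, side g = false ∧ ¬ (ends g).IsDiag)
    (h12 : a₁ ≠ a₂) (h13 : a₁ ≠ a₃) (h23 : a₂ ≠ a₃) (ho1 : o ≠ a₁) (ho2 : o ≠ a₂) (ho3 : o ≠ a₃)
    (hob : o ≠ b) (hb1 : b ≠ a₁) (hb2 : b ≠ a₂) (hb3 : b ≠ a₃) :
    A3PendantCut ends side L v Rt o a₁ a₂ a₃ b ∨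
      A3PendantCut ends (fun e => !side e) Rt v L o a₁ a₂ a₃ b := by
  rcases pos_a3_of_not_a3ToMarks hcut h.notR3 with ⟨h3L, h3Lv⟩ | ⟨h3V, h3Lv, h3Rv⟩ | ⟨h3R, h3Rv⟩
  · exact shape_cases_a3_left h hcut hR h12 ho1 ho2 hob hb1 hb2 h3L h3Lv
  · exact (shape_cases_a3_at_v h hcut hL hR h13 h23 ho3 hb3 h3V h3Lv h3Rv).elim
  · exact shape_cases_a3_right h hcut hL h12 ho1 ho2 hob hb1 hb2 h3R h3Rv

end Main

section Consequences

variable {V : Type*} {E : Type*} [Fintype E] [DecidableEq V]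
variable {ends : E → Sym2 V} {side : E → Bool} {L : Set V} {v : V} {Rt : Set V} {o a₁ a₂ a₃ b : V}

/-- In the `a₃`-pendant shape, `a₃` is a leaf. -/
lemma nonLoopDeg_a3_eq_one_of_shape (hcut : CutVertex ends side L v Rt)
    (hs : A3PendantCut ends side L v Rt o a₁ a₂ a₃ b) : nonLoopDeg ends a₃ = 1 := by
  obtain ⟨e, he, huniq⟩ := hs.edge
  have hv3 : v ≠ a₃ := fun h' => hs.unmarked_v.2.2.2.1 h'
  have hed : ¬ (ends e).IsDiag := by
    rw [he, Sym2.mk_isDiag_iff]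
    exact fun h' => hv3 h'.symm
  exact nonLoopDeg_eq_one_of_unique hs.a3_left hcut (by rw [he]; exact Sym2.mem_mk_left _ _) hed
    huniq

/-- In the `a₃`-pendant shape on the residual, the cut vertex has non-loop degree `≥ 3`. -/
lemma three_le_nonLoopDeg_v_of_shape (h : WReducedI ends o a₁ a₂ a₃ b)
    (hs : A3PendantCut ends side L v Rt o a₁ a₂ a₃ b) : 3 ≤ nonLoopDeg ends v := by
  obtain ⟨e, he, -⟩ := hs.edge
  have hv3 : v ≠ a₃ := fun h' => hs.unmarked_v.2.2.2.1 h'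
  have hed : ¬ (ends e).IsDiag := by
    rw [he, Sym2.mk_isDiag_iff]
    exact fun h' => hv3 h'.symm
  have hpos : 0 < nonLoopDeg ends v :=
    Finset.card_pos.mpr ⟨e, mem_edgesAt.mpr ⟨by rw [he]; exact Sym2.mem_mk_right _ _, hed⟩⟩
  obtain ⟨h1, h2⟩ := h.unmarked v hs.unmarked_v
  omega

/-- **Beyond (G1) the residual is two-connected**: on `WReducedI` with `a₃` not a leaf, no cut
vertex has a non-loop edge on each side. -/
theorem no_cutVertex_of_wredI_of_a3_not_leaf (h : WReducedI ends o a₁ a₂ a₃ b)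
    (hd3 : nonLoopDeg ends a₃ ≠ 1) (hcut : CutVertex ends side L v Rt)
    (hL : ∃ g, side g = true ∧ ¬ (ends g).IsDiag) (hR : ∃ g, side g = false ∧ ¬ (ends g).IsDiag)
    (h12 : a₁ ≠ a₂) (h13 : a₁ ≠ a₃) (h23 : a₂ ≠ a₃) (ho1 : o ≠ a₁) (ho2 : o ≠ a₂) (ho3 : o ≠ a₃)
    (hob : o ≠ b) (hb1 : b ≠ a₁) (hb2 : b ≠ a₂) (hb3 : b ≠ a₃) : False := by
  rcases cutVertex_shape_of_wredI h hcut hL hR h12 h13 h23 ho1 ho2 ho3 hob hb1 hb2 hb3 with hs | hs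
  · exact hd3 (nonLoopDeg_a3_eq_one_of_shape hcut hs)
  · exact hd3 (nonLoopDeg_a3_eq_one_of_shape hcut.symm hs)

end Consequences

end WRed

end Summit.Ventures.PercRepro2
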